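import Literature.NumberTheory.LFunctions.Zhang2022.RepairRplusWallZero
import Literature.NumberTheory.LFunctions.Zhang2022.SkeletonAssembly

/-!
# Zhang (2022) §18-margin repair rung — barrier extension `R⁺⁺`: the band slot E-004 and the FROM-THE-WALL families
# restated at the MAIN scale `𝔞𝔓` (units fix of `RepairBandSlot.lean` / `RepairRplusWallZero.lean`)

Trunk T-ANT (NumberTheory/LFunctions). Y. Zhang, *Discrete mean estimates and the Landau–Siegel
zero*, arXiv:2211.02515v1 (2022) [Zhang2022LandauSiegel] — **an unrefereed manuscript under
adjudication. WHAT THIS IS NOT: nothing here asserts or denies its Theorems 1–2 or any analytic lemma;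
no claim about Landau–Siegel zeros, about Parity, or about a repaired `Margin232` is made; `DiscMeanBandMain`
below is an E*-SLOT — a hypothesis SHAPE (bare `Prop`, registry E-004 at the main scale), displayed where used,
NEVER asserted.** Cell `landau-siegel` (rung F-S3), sub-cell E, seat ls-barrier-p2 (units finding 2026-08-26T20:1xZ).

**Why this file (units).** The slots of record `Repair.DiscMeanBandWidth`/`DiscMeanBandWidthOn`/`DiscMeanBandWidthWall0`
(p457769/p458872) and the registry form `KnifeEdge.DiscMeanUpperWidth` (p457290) bound the band by
`C·width·discWeight`, where `discWeight = Σ|Re 𝔠*·Re ω|` is the TRIVIAL scale: under Lemma 2.3 / Prop 2.2 (i) it is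
the discrete mean of the constant table `h ≡ 1`, and Prop 7.1 + Lemma 8.1 at the unit sequence give
`discWeight = (8/π)·log P·𝔓 + O(𝓛²𝔓) = (8/π)𝓛⁹𝔓(1 + o(1))` (`S_j(δ,δ) = κ(1) = 1`, `mainMV(δ,δ) = (4/π)·log P·𝔓`),
whereas every main term of the method is `𝔠·𝔞𝔓` with `𝔞 = (6/π²)L′(1,χ)²∏q/(q+1) ≪ 𝓛⁴`. So `discWeight/(𝔞𝔓) ≥ c𝓛⁵ → ∞`
and a bound `C·w·discWeight` at FIXED `w` permits band contributions far above the main scale: the trivial-scale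
slots are expected true with room but are not probative at main order, and the conditional verdicts of
`familyWallZero`/`familyWallZeroTop` (p459259, bundle E-8) are trivial-scale statements. Here the SAME chain is
restated with the slot at the MAIN scale:

* `DiscMeanBandMainOn V c′ w η` / `DiscMeanBandMain c′ w η` (wall value zero; E-004 AT THE MAIN SCALE; kind (c),
  displayed, never asserted): for all large `D`, every real primitive `χ (mod D)`, under the displayed (A)-hypothesis
  `Re ρ = ½` (kind (b)), for every profile `g` of the class (globally 1-Lipschitz, `‖g‖∞ ≤ 1`, `g(1) = 0`), the band
  block `⌈P⌉ ≤ n < ⌈P^{1+w}⌉` changes the discrete mean by at most `η·(discMeanAbs(⌈P⌉) + 𝔞·𝔓)`. Expected TRUE for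
  every `w ∈ (0,1)` and every `η > 0` (theory custodian 2026-08-26T11:35:37Z: a wall-vanishing Lipschitz piece in the
  band `[1, 1+α̃]`, height `≲ 𝓛⁻⁸`, is «safe iff `𝔞 ≫ 𝓛^{−5.9}`»; beyond `1 + α̃` the tail is Pólya–Vinogradov-invisible;
  cross term by Cauchy–Schwarz) — a derivation, NOT in tree; its NEGATION at some `(w, η)` = a band MAIN TERM
  `≥ η𝔞𝔓` for a wall-vanishing profile = an input of E*-strength. No implication to or from `DiscMeanBandWidthWall0`
  is claimed (different scales).
* `discMean_fromWall_of_bandMainOn`, `discMean_fromWall_topVanishing_of_bandMainOn` — the conditional chains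
  (slot + `KnifeEdgeSmoothClass.discMeanFlat_lengths`/`_topVanishing`, p456962), verbatim the p458872/p459259
  proofs with the slot carried.
* `familyWallZeroMain`, `familyWallZeroTopMain` (+ `_decided`, `rplus_wallZeroMain_decided`): Design and class =
  `WallZeroDesign`/`WallZeroTopDesign` of p459259 UNCHANGED (so the C4 witnesses `inClass_triangle`/`inClassTop_triangle`
  apply by name); Verdict: for every `w > 0` [`w < δ`], every `η`, IF `DiscMeanBandMain c′ w η` then eventually, under
  (b), for every admissible length `N ≥ ⌈P^{1+w}⌉`,
  `¬ (η·(discMeanAbs⌈P⌉ + 𝔞𝔓) + P^{−w/8}·(discMeanAbs⌈P^{1+w}⌉ + discWeight) < |discMean N − discMean ⌈P⌉|)`.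
  READING (now at main order): closing past the wall in the smooth wall-zero class by a main-order amount `κ𝔞𝔓`
  needs `¬ DiscMeanBandMain c′ w η` for every `w` and every `η < κ/(𝔅-size of the bulk + 1)` — the far-tail term
  `P^{−w/8}·discWeight = P^{−w/8}·O(𝓛⁹𝔓)` IS `o(𝔞𝔓)`.
* bookkeeping: `DiscMeanBandMainOn.anti` (class), `DiscMeanBandMainOn.mono` (`η`).

CURRENCY (REF-E C3(e)): discrete mean over the sampled zeros; (b) `Re ρ = ½` and (c) the main-scale slot displayed.

## References

* Y. Zhang, arXiv:2211.02515v1 (2022), §2 (2.14)–(2.20), (2.30)–(2.31), §7 Prop 7.1 (7.2) [p. 44], §8 Lemma 8.1.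
  [cite: Zhang2022LandauSiegel, §§2, 7, 8]
-/

noncomputable section

open Real Complex
open scoped NNReal

namespace Literature.NumberTheory.LFunctions.Zhang2022

namespace Repair

/-! ### The slot at the main scale (`𝔞 ≥ 0`, `𝔓 ≥ 0`: `Skeleton.frakA_nonneg`, `Skeleton.frakP_nonneg`) -/

/-- **E-004 AT THE MAIN SCALE over a profile class `V` (hypothesis shape; NOT asserted):** for all large `D`, every real
primitive `χ (mod D)`, under the displayed (A)-hypothesis, for every profile `g` with `V g`, the band block
`⌈P⌉ ≤ n < ⌈P^{1+w}⌉` changes the discrete mean by at most `η·(discMeanAbs(⌈P⌉) + 𝔞·𝔓)` — the BULK's absolute discrete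
mean plus the MAIN scale `𝔞𝔓` of the method (NOT the trivial scale `discWeight ≍ 𝓛⁹𝔓`).
[cite: Zhang2022LandauSiegel, §2 (2.16)–(2.20), (2.31); §8 Lemma 8.1] -/
def DiscMeanBandMainOn (V : (ℝ → ℂ) → Prop) (c' w η : ℝ) : Prop :=
  Skeleton.ForAllLarge fun D _ χ =>
    (∀ i ∈ Skeleton.idx χ, (i.2).re = 1 / 2) →
      ∀ g : ℝ → ℂ, V g →
        |discMean c' χ g ⌈Skeleton.bigP D ^ (1 + w)⌉₊ - discMean c' χ g ⌈Skeleton.bigP D⌉₊| ≤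
          η * (discMeanAbs c' χ g ⌈Skeleton.bigP D⌉₊ + Skeleton.frakA χ * frakP D)

/-- **E-004 AT THE MAIN SCALE, SLOT OF RECORD for the wall-value-zero class** (globally 1-Lipschitz, `‖g‖∞ ≤ 1`,
`g(1) = 0`; hypothesis shape, displayed where used, NOT asserted). Expected true for every `w ∈ (0,1)`, `η > 0`
(derivation, not in tree); its negation = a band main term of E*-strength for a wall-vanishing profile.
[cite: Zhang2022LandauSiegel, §2 (2.16)–(2.20), (2.30)–(2.31); §8 Lemma 8.1] -/
def DiscMeanBandMain (c' w η : ℝ) : Prop :=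
  DiscMeanBandMainOn (fun g => LipschitzWith 1 g ∧ (∀ z, ‖g z‖ ≤ 1) ∧ g 1 = 0) c' w η

/-- The main-scale slot is antitone in the class. [cite: Zhang2022LandauSiegel, §2 (2.16)–(2.20)] -/
theorem DiscMeanBandMainOn.anti {V V' : (ℝ → ℂ) → Prop} {c' w η : ℝ} (hVV : ∀ g, V g → V' g)
    (h : DiscMeanBandMainOn V' c' w η) : DiscMeanBandMainOn V c' w η :=
  Skeleton.ForAllLarge.mono h fun _ _ _ _ _ hB hA g hg => hB hA g (hVV g hg)

/-- The main-scale slot is monotone in `η`. [cite: Zhang2022LandauSiegel, §2 (2.16)–(2.20)] -/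
theorem DiscMeanBandMainOn.mono {V : (ℝ → ℂ) → Prop} {c' w η η' : ℝ} (hη : η ≤ η')
    (h : DiscMeanBandMainOn V c' w η) : DiscMeanBandMainOn V c' w η' := by
  refine Skeleton.ForAllLarge.mono h ?_
  intro D _ χ _ _ hB hA g hg
  refine (hB hA g hg).trans (mul_le_mul_of_nonneg_right hη ?_)
  exact add_nonneg (Finset.sum_nonneg fun _ _ => mul_nonneg (abs_nonneg _) (sq_nonneg _))
    (mul_nonneg (Skeleton.frakA_nonneg χ) (Skeleton.frakP_nonneg D))

/-! ### Conditional flatness from the wall, main-scale slot -/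

/-- **From the wall to any bounded length, conditionally on the main-scale band slot over a class `V` of profiles
1-Lipschitz and bounded by `1` on `[1, ∞)`:** slot on `V` at `(w, η)` and `0 < w < δ` give, eventually and under the
displayed (A)-hypothesis, for every `g` with `V g` and every `⌈P^{1+w}⌉ ≤ N ≤ ⌈P^{1+δ}⌉`,
`|discMean(N) − discMean(⌈P⌉)| ≤ η·(discMeanAbs(⌈P⌉) + 𝔞𝔓) + P^{−w/8}·(discMeanAbs(⌈P^{1+w}⌉) + discWeight)`.
[cite: Zhang2022LandauSiegel, §2 (2.16)–(2.20); §8 Lemma 8.1] -/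
theorem discMean_fromWall_of_bandMainOn {V : (ℝ → ℂ) → Prop} (c' : ℝ) {w δ η : ℝ} (hw : 0 < w) (hwδ : w < δ)
    (hV : ∀ g, V g → LipschitzOnWith 1 g (Set.Ici 1) ∧ ∀ z : ℝ, 1 ≤ z → ‖g z‖ ≤ 1)
    (hB : DiscMeanBandMainOn V c' w η) :
    Skeleton.ForAllLarge fun D _ χ =>
      (∀ i ∈ Skeleton.idx χ, (i.2).re = 1 / 2) →
        ∀ g : ℝ → ℂ, V g →
          ∀ N : ℕ, ⌈Skeleton.bigP D ^ (1 + w)⌉₊ ≤ N → N ≤ ⌈Skeleton.bigP D ^ (1 + δ)⌉₊ →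
            |discMean c' χ g N - discMean c' χ g ⌈Skeleton.bigP D⌉₊| ≤
              η * (discMeanAbs c' χ g ⌈Skeleton.bigP D⌉₊ + Skeleton.frakA χ * frakP D) +
                Skeleton.bigP D ^ (-(w / 8)) *
                  (discMeanAbs c' χ g ⌈Skeleton.bigP D ^ (1 + w)⌉₊ + discWeight c' χ) := by
  have hT : Skeleton.ForAllLarge fun D _ χ =>
      (∀ i ∈ Skeleton.idx χ, (i.2).re = 1 / 2) →
        ∀ (g : ℝ → ℂ) (K : ℝ≥0) (M : ℝ), LipschitzOnWith K g (Set.Ici 1) →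
          (∀ z : ℝ, 1 ≤ z → ‖g z‖ ≤ M) →
          ∀ N₁ N₂ : ℕ, ⌈Skeleton.bigP D ^ (1 + w)⌉₊ ≤ N₁ → N₁ ≤ N₂ → N₂ ≤ ⌈Skeleton.bigP D ^ (1 + δ)⌉₊ →
            |discMean c' χ g N₂ - discMean c' χ g N₁| ≤
              Skeleton.bigP D ^ (-(w / 8)) * (discMeanAbs c' χ g N₁ + max (K : ℝ) M ^ 2 * discWeight c' χ) :=
    KnifeEdgeSmoothClass.discMeanFlat_lengths c' hw hwδ
  refine (Skeleton.ForAllLarge.and hB hT).mono ?_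
  intro D _ χ _ _ h hA g hg N hN₁ hN₂
  have h1 := h.1 hA g hg
  have h2 := h.2 hA g 1 1 (hV g hg).1 (hV g hg).2 _ N le_rfl hN₁ hN₂
  have h2' : |discMean c' χ g N - discMean c' χ g ⌈Skeleton.bigP D ^ (1 + w)⌉₊| ≤
      Skeleton.bigP D ^ (-(w / 8)) * (discMeanAbs c' χ g ⌈Skeleton.bigP D ^ (1 + w)⌉₊ + discWeight c' χ) := by
    simpa using h2
  calc |discMean c' χ g N - discMean c' χ g ⌈Skeleton.bigP D⌉₊|
      = |(discMean c' χ g ⌈Skeleton.bigP D ^ (1 + w)⌉₊ - discMean c' χ g ⌈Skeleton.bigP D⌉₊) +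
          (discMean c' χ g N - discMean c' χ g ⌈Skeleton.bigP D ^ (1 + w)⌉₊)| := by ring_nf
    _ ≤ |discMean c' χ g ⌈Skeleton.bigP D ^ (1 + w)⌉₊ - discMean c' χ g ⌈Skeleton.bigP D⌉₊| +
          |discMean c' χ g N - discMean c' χ g ⌈Skeleton.bigP D ^ (1 + w)⌉₊| := abs_add_le _ _
    _ ≤ _ := add_le_add h1 h2'

/-- **From the wall to the FULL polynomial of a top-vanishing piece, conditionally on the main-scale band slot over a
class `V`** (profiles 1-Lipschitz and bounded by `1` on `[1, ∞)`): slot at `(w, η)` and `0 < w < δ` give, eventually and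
under (b), for every `g` with `V g` vanishing on `[θ, ∞)`, `θ ≤ 1 + δ`, and EVERY `N ≥ ⌈P^{1+w}⌉`, the same bound.
[cite: Zhang2022LandauSiegel, §2 (2.16)–(2.20); §8 Lemma 8.1] -/
theorem discMean_fromWall_topVanishing_of_bandMainOn {V : (ℝ → ℂ) → Prop} (c' : ℝ) {w δ η : ℝ} (hw : 0 < w)
    (hwδ : w < δ) (hV : ∀ g, V g → LipschitzOnWith 1 g (Set.Ici 1) ∧ ∀ z : ℝ, 1 ≤ z → ‖g z‖ ≤ 1)
    (hB : DiscMeanBandMainOn V c' w η) :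
    Skeleton.ForAllLarge fun D _ χ =>
      (∀ i ∈ Skeleton.idx χ, (i.2).re = 1 / 2) →
        ∀ g : ℝ → ℂ, V g → ∀ θ : ℝ, θ ≤ 1 + δ → (∀ z, θ ≤ z → g z = 0) →
          ∀ N : ℕ, ⌈Skeleton.bigP D ^ (1 + w)⌉₊ ≤ N →
            |discMean c' χ g N - discMean c' χ g ⌈Skeleton.bigP D⌉₊| ≤
              η * (discMeanAbs c' χ g ⌈Skeleton.bigP D⌉₊ + Skeleton.frakA χ * frakP D) +
                Skeleton.bigP D ^ (-(w / 8)) *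
                  (discMeanAbs c' χ g ⌈Skeleton.bigP D ^ (1 + w)⌉₊ + discWeight c' χ) := by
  refine (Skeleton.ForAllLarge.and hB (discMean_flat_topVanishing c' hw hwδ)).mono ?_
  intro D _ χ _ _ h hA g hg θ hθ hg0 N hN
  have h1 := h.1 hA g hg
  have h2 := h.2 hA g 1 1 (hV g hg).1 (hV g hg).2 θ hθ hg0 N hN
  have h2' : |discMean c' χ g N - discMean c' χ g ⌈Skeleton.bigP D ^ (1 + w)⌉₊| ≤
      Skeleton.bigP D ^ (-(w / 8)) * (discMeanAbs c' χ g ⌈Skeleton.bigP D ^ (1 + w)⌉₊ + discWeight c' χ) := by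
    simpa using h2
  calc |discMean c' χ g N - discMean c' χ g ⌈Skeleton.bigP D⌉₊|
      = |(discMean c' χ g ⌈Skeleton.bigP D ^ (1 + w)⌉₊ - discMean c' χ g ⌈Skeleton.bigP D⌉₊) +
          (discMean c' χ g N - discMean c' χ g ⌈Skeleton.bigP D ^ (1 + w)⌉₊)| := by ring_nf
    _ ≤ |discMean c' χ g ⌈Skeleton.bigP D ^ (1 + w)⌉₊ - discMean c' χ g ⌈Skeleton.bigP D⌉₊| +
          |discMean c' χ g N - discMean c' χ g ⌈Skeleton.bigP D ^ (1 + w)⌉₊| := abs_add_le _ _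
    _ ≤ _ := add_le_add h1 h2'

/-- The wall-value-zero class restricts to «1-Lipschitz and bounded by `1` on `[1, ∞)`». [cite: Zhang2022LandauSiegel, §7 (7.2) p.44] -/
private theorem wallZeroClass_restrict (g : ℝ → ℂ) (hg : LipschitzWith 1 g ∧ (∀ z, ‖g z‖ ≤ 1) ∧ g 1 = 0) :
    LipschitzOnWith 1 g (Set.Ici 1) ∧ ∀ z : ℝ, 1 ≤ z → ‖g z‖ ≤ 1 :=
  ⟨hg.1.lipschitzOnWith, fun z _ => hg.2.1 z⟩

/-! ### The from-the-wall families at the main scale -/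

/-- **Verdict at the MAIN scale** «no main-order gain over the bulk below `P` at ANY length `⌈P^{1+w}⌉ ≤ N ≤ ⌈P^{1+δ}⌉`»,
for every `0 < w < δ` and every `η`, with the main-scale band slot `DiscMeanBandMain c′ w η` (kind (c)) and the
(A)-hypothesis (kind (b)) DISPLAYED. [cite: Zhang2022LandauSiegel, §2 (2.16)–(2.20), (2.31); §8 Lemma 8.1] -/
def WallZeroDesign.VerdictMain (d : WallZeroDesign) : Prop :=
  ∀ ⦃w δ η : ℝ⦄, 0 < w → w < δ → DiscMeanBandMain d.c' w η →
    Skeleton.ForAllLarge fun D _ χ =>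
      (∀ i ∈ Skeleton.idx χ, (i.2).re = 1 / 2) →
        ∀ N : ℕ, ⌈Skeleton.bigP D ^ (1 + w)⌉₊ ≤ N → N ≤ ⌈Skeleton.bigP D ^ (1 + δ)⌉₊ →
          ¬ (η * (discMeanAbs d.c' χ d.g ⌈Skeleton.bigP D⌉₊ + Skeleton.frakA χ * frakP D) +
                Skeleton.bigP D ^ (-(w / 8)) *
                  (discMeanAbs d.c' χ d.g ⌈Skeleton.bigP D ^ (1 + w)⌉₊ + discWeight d.c' χ) <
              |discMean d.c' χ d.g N - discMean d.c' χ d.g ⌈Skeleton.bigP D⌉₊|)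

/-- **The slice theorem at the main scale** `∀ d, K d → VerdictMain d` (class `WallZeroDesign.InClass` of p459259
unchanged). [cite: Zhang2022LandauSiegel, §2 (2.16)–(2.20); §8 Lemma 8.1] -/
theorem WallZeroDesign.verdictMain_of_inClass (d : WallZeroDesign) (h : d.InClass) : d.VerdictMain := by
  intro w δ η hw hwδ hB
  refine (discMean_fromWall_of_bandMainOn d.c' hw hwδ wallZeroClass_restrict hB).mono ?_
  intro D _ χ _ _ hflat hA N hN₁ hN₂
  exact not_lt.2 (hflat hA d.g h N hN₁ hN₂)

/-- family «wall value zero, from the wall to any bounded length, MAIN-scale band slot displayed, discrete-mean currency».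
[cite: Zhang2022LandauSiegel, §2 (2.16)–(2.20); §8 Lemma 8.1] -/
def familyWallZeroMain : DesignFamily where
  Design := WallZeroDesign
  InClass := WallZeroDesign.InClass
  Verdict := WallZeroDesign.VerdictMain

/-- **`familyWallZeroMain` is decided.** [cite: Zhang2022LandauSiegel, §2 (2.16)–(2.20); §8 Lemma 8.1] -/
theorem familyWallZeroMain_decided : familyWallZeroMain.Decided :=
  fun d h => WallZeroDesign.verdictMain_of_inClass d h

/-- **Verdict at the MAIN scale, top-vanishing**: the FULL polynomial (every `N ≥ ⌈P^{1+w}⌉`) gains nothing at main order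
over the bulk below `P`, for every `w > 0` and `η`, main-scale band slot and (A)-hypothesis displayed.
[cite: Zhang2022LandauSiegel, §2 (2.16)–(2.20), (2.31)] -/
def WallZeroTopDesign.VerdictMain (d : WallZeroTopDesign) : Prop :=
  ∀ ⦃w η : ℝ⦄, 0 < w → DiscMeanBandMain d.c' w η →
    Skeleton.ForAllLarge fun D _ χ =>
      (∀ i ∈ Skeleton.idx χ, (i.2).re = 1 / 2) →
        ∀ N : ℕ, ⌈Skeleton.bigP D ^ (1 + w)⌉₊ ≤ N →
          ¬ (η * (discMeanAbs d.c' χ d.g ⌈Skeleton.bigP D⌉₊ + Skeleton.frakA χ * frakP D) +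
                Skeleton.bigP D ^ (-(w / 8)) *
                  (discMeanAbs d.c' χ d.g ⌈Skeleton.bigP D ^ (1 + w)⌉₊ + discWeight d.c' χ) <
              |discMean d.c' χ d.g N - discMean d.c' χ d.g ⌈Skeleton.bigP D⌉₊|)

/-- **The slice theorem at the main scale, top-vanishing** (`δ = |θ − 1| + 2w`).
[cite: Zhang2022LandauSiegel, §2 (2.16)–(2.20); §8 Lemma 8.1] -/
theorem WallZeroTopDesign.verdictMain_of_inClass (d : WallZeroTopDesign) (h : d.InClass) : d.VerdictMain := by
  intro w η hw hB
  have hwδ : w < |d.θ - 1| + 2 * w := by have := abs_nonneg (d.θ - 1); linarith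
  have hθ : d.θ ≤ 1 + (|d.θ - 1| + 2 * w) := by have := le_abs_self (d.θ - 1); linarith
  refine (discMean_fromWall_topVanishing_of_bandMainOn d.c' hw hwδ wallZeroClass_restrict hB).mono ?_
  intro D _ χ _ _ hflat hA N hN
  exact not_lt.2 (hflat hA d.g h.1 d.θ hθ h.2 N hN)

/-- family «wall value zero, top-vanishing, full polynomial vs bulk, MAIN-scale band slot displayed».
[cite: Zhang2022LandauSiegel, §2 (2.16)–(2.20); §8 Lemma 8.1] -/
def familyWallZeroTopMain : DesignFamily where
  Design := WallZeroTopDesign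
  InClass := WallZeroTopDesign.InClass
  Verdict := WallZeroTopDesign.VerdictMain

/-- **`familyWallZeroTopMain` is decided.** [cite: Zhang2022LandauSiegel, §2 (2.16)–(2.20); §8 Lemma 8.1] -/
theorem familyWallZeroTopMain_decided : familyWallZeroTopMain.Decided :=
  fun d h => WallZeroTopDesign.verdictMain_of_inClass d h

/-! ### C4 (the p459259 witnesses apply by name: same class) and the extension step -/

/-- C4: the triangular overhang (`1 ≤ θ ≤ 3`) is a member of `familyWallZeroMain`'s class (= `inClass_triangle`).
[cite: Zhang2022LandauSiegel, §7 (7.2) p.44] -/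
theorem familyWallZeroMain_inClass_triangle (c' : ℝ) {θ : ℝ} (hθ : 1 ≤ θ) (hθ3 : θ ≤ 3) :
    familyWallZeroMain.InClass (WallZeroDesign.mk c' fun y => ((max 0 (min (y - 1) (θ - y)) : ℝ) : ℂ)) :=
  inClass_triangle c' hθ hθ3

/-- C4: the same, with declared length `θ`, for `familyWallZeroTopMain` (= `inClassTop_triangle`).
[cite: Zhang2022LandauSiegel, §7 (7.2) p.44] -/
theorem familyWallZeroTopMain_inClass_triangle (c' : ℝ) {θ : ℝ} (hθ : 1 ≤ θ) (hθ3 : θ ≤ 3) :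
    familyWallZeroTopMain.InClass
      (WallZeroTopDesign.mk ⟨c', fun y => ((max 0 (min (y - 1) (θ - y)) : ℝ) : ℂ)⟩ θ) :=
  inClassTop_triangle c' hθ hθ3

/-- **`R⁺⁺`-step of this file**: `ClassDecided (Rplus ++ [familyWallZeroMain, familyWallZeroTopMain])`.
[cite: Zhang2022LandauSiegel, §2 (2.32)–(2.33); §7 (7.2) p.44] -/
theorem rplus_wallZeroMain_decided : ClassDecided (Rplus ++ [familyWallZeroMain, familyWallZeroTopMain]) :=
  classDecided_append.2
    ⟨rplus_decided, classDecided_cons familyWallZeroMain_decided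
      (classDecided_cons familyWallZeroTopMain_decided classDecided_nil)⟩

end Repair

end Literature.NumberTheory.LFunctions.Zhang2022
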